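import Summits.ResolutionOfSingularities.ResolutionOfSingularities.Theorems.FrobeniusClosingPatchingRelPerfectCrossingLinesTower
import Summits.ResolutionOfSingularities.ResolutionOfSingularities.Theorems.FrobeniusClosingPatchingRelPerfectCrossingLinesCharts
import Summits.ResolutionOfSingularities.ResolutionOfSingularities.Theorems.FrobeniusClosingPatchingRelPerfectCrossingLinesAlgebra
import Summits.ResolutionOfSingularities.ResolutionOfSingularities.Theorems.FrobeniusClosingPatchingRelPerfectTwoQuadricMember
import HarnessLib

/-!
# Crux `PatchingRelPerfect` (stmt-ResolutionOfSingularities-16161), chain W5.2 — the CROSSING-LINES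
# member `I = (x₀x₁ + x₂x₃, x₃²) + 𝔪⁴`, part 6: the member is in the companion class `𝒞`

[OURS · L1 W5.2 · kernel certificate, res-L1-w52-plan-1 NAMING 2026-08-27T17:00:47Z (O2′)]
The first member of the `𝔪`-primary stratum of the open core with a POLE of member/host
TANGENCY type: `I = (q, x₃²) + 𝔪⁴`, `q = x₀x₁ + x₂x₃`, `S` regular local with regular system of
parameters `x₀, …, x₃` (any characteristic, any residue field).  On `Bl_𝔪`: `I𝒪 = 𝓘_E² · K`,
`K = (w̃) + (p̃²) + (𝓘_E²)`, `w̃` the (regular) strict transform of the rank-4 quadric cone `V(q)`,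
`p̃ = x₃/x_i`; `cosupp K` = the two LINES `L₀ = {x₀ = x₃ = 0}`, `L₁ = {x₁ = x₃ = 0}` of `E` crossing
at `c = [0:0:1:0]`, along which the member `V(p̃)` is TANGENT to the host.  Hand tower (5 regular
centres): `𝔪 → L₀ → S₁ = H′ ∩ F₁ → L₁″ → S₂ = H‴ ∩ F₃ → END`, realised by ONE companion
`Q = P₁P₂P₃P₄ · 𝔪`, `P₁ = (x₀, x₃) + 𝔪²`, `P₂ = (q) + P₁²`, `P₃ = q𝔪 + P₁((x₃) + 𝔪²)𝔪`,
`P₄ = qP₁²𝔪² + P₃²`.  PROVED: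

* `CrossingLines.map_member_mul_Q₀` — on every Rees chart `B_i` of `Bl_𝔪`:
  `(I · P₁P₂P₃P₄) B_i = u¹⁴ · (K · J₁ · A₁ · T₁) · C` with `C = (e₀, e₃, u)`, `D = (e₃, u)`,
  `J₁ = (w) + C²`, `A₁ = (w) + C·D`, `T₁ = (w)·C² + A₁²`, `w = e₀e₁ + e₂e₃`;
* `CrossingLines.isRegular_charts` — chart `x₃`: unit; chart `x₀`: the two-quadric conic tower
  (`TwoQuadric.conicTower_isRegular`, p543390) along `L₁`; chart `x₁`: the conic tower along `L₀`
  with the avatars of the absent centres (`conicTowerPlus_isRegular`, part 4); chart `x₂`: the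
  crossing tower (`crossingTower_isRegular`, part 3b), hypotheses by part 5;
* `CrossingLines.companion_member` (`Q ⊇ 𝔪²²`), `coreRung_member`, `coreRung_member_of_ringKrullDim`,
  **`atomDimFourBlowupAt_member`** — `I ∈ 𝒞` in the registered binder shape of `stub_atomDimFourBlowup`.

RESIDUAL / POLE record (plan-1 RULING G11-25 A8/A9): every pole is (P-reg) (the only host is the
regular strict transform of a rank-4 quadric; no (P-cone) pole); at the tangency pole `c` the
residual `K♭|_H = (a²b², u²)` is MONOMIAL in the host coordinates `(u, a, b)` and is emptied by
the two line blow-ups — «END-then-local-principalisation» holds at a tangency pole.  Fact-free;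
nothing here is a statement of the manuscript under review (AI-written; AI review weaker than
expert review).

## References

* Q. Liu, *Algebraic Geometry and Arithmetic Curves*, OUP 2002, Thm. 8.1.19 (a). [Liu2002]
* The Stacks Project, Tags 080A, 080B, 0804, 0BIQ. [StacksProject]
* U. Görtz, T. Wedhorn, *Algebraic Geometry I* (2nd ed., 2020), Prop. 13.91 (2). [GortzWedhorn2020]
-/

-- `Summit.<Summit>.<Sub>.Theorems` with `Sub = Summit` (single-conjunct summit, D-0017)
set_option linter.dupNamespace false

noncomputable section

open CategoryTheory CategoryTheory.Limits AlgebraicGeometry Literature.AlgebraicGeometry.Resolution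
open scoped Pointwise nonZeroDivisors

namespace Summit.ResolutionOfSingularities.ResolutionOfSingularities.Theorems

universe u

namespace CrossingLines

open CuspMember TwoQuadric

section Algebra

variable {A : Type u} [CommRing A]

/-- Collecting the Cartier twist: `(u²K)(uC · u²J · u³P · u⁶T) = u¹⁴ · ((K J P T) C)`. [folklore] -/
theorem collect_member (u : A) (K C J P T : Ideal A) :
    Ideal.span {u ^ 2} * K * (Ideal.span {u} * C * (Ideal.span {u ^ 2} * J) * (Ideal.span {u ^ 3} * P) *
      (Ideal.span {u ^ 6} * T)) = Ideal.span {u ^ 14} * ((K * J * P * T) * C) := by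
  rw [← Ideal.span_singleton_pow, ← Ideal.span_singleton_pow, ← Ideal.span_singleton_pow,
    ← Ideal.span_singleton_pow]
  ring

/-- `(u e₀, u e₃, u²) = u · ((e₀) + (e₃) + (u))`. [folklore] -/
theorem factor_three (u a b : A) :
    Ideal.span {u * a} ⊔ Ideal.span {u * b} ⊔ Ideal.span {u ^ 2} =
      Ideal.span {u} * (Ideal.span {a} ⊔ Ideal.span {b} ⊔ Ideal.span {u}) := by
  rw [sq, Ideal.mul_sup, Ideal.mul_sup, Ideal.span_singleton_mul_span_singleton,
    Ideal.span_singleton_mul_span_singleton, Ideal.span_singleton_mul_span_singleton]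

/-- `(u e₃, u²) = u · ((e₃) + (u))`. [folklore] -/
theorem factor_two (u b : A) :
    Ideal.span {u * b} ⊔ Ideal.span {u ^ 2} = Ideal.span {u} * (Ideal.span {b} ⊔ Ideal.span {u}) := by
  rw [sq, Ideal.mul_sup, Ideal.span_singleton_mul_span_singleton, Ideal.span_singleton_mul_span_singleton]

/-- `P₂ ↦ u² · J₁`. [folklore] -/
theorem factor_P₂ (u w : A) (C : Ideal A) :
    Ideal.span {u ^ 2 * w} ⊔ (Ideal.span {u} * C) ^ 2 = Ideal.span {u ^ 2} * (Ideal.span {w} ⊔ C ^ 2) := by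
  rw [mul_pow, Ideal.span_singleton_pow, Ideal.mul_sup, Ideal.span_singleton_mul_span_singleton]

/-- `P₃ ↦ u³ · A₁`. [folklore] -/
theorem factor_P₃ (u w : A) (C D : Ideal A) :
    Ideal.span {u ^ 2 * w} * Ideal.span {u} ⊔ Ideal.span {u} * C * (Ideal.span {u} * D) * Ideal.span {u} =
      Ideal.span {u ^ 3} * (Ideal.span {w} ⊔ C * D) := by
  rw [← Ideal.span_singleton_mul_span_singleton, ← Ideal.span_singleton_pow, ← Ideal.span_singleton_pow,
    ← Submodule.add_eq_sup, ← Submodule.add_eq_sup]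
  ring

/-- `P₄ ↦ u⁶ · T₁`. [folklore] -/
theorem factor_P₄ (u w : A) (C P : Ideal A) :
    Ideal.span {u ^ 2 * w} * (Ideal.span {u} * C) ^ 2 * Ideal.span {u} ^ 2 ⊔ (Ideal.span {u ^ 3} * P) ^ 2 =
      Ideal.span {u ^ 6} * (Ideal.span {w} * C ^ 2 ⊔ P ^ 2) := by
  rw [← Ideal.span_singleton_mul_span_singleton, ← Ideal.span_singleton_pow, ← Ideal.span_singleton_pow,
    ← Ideal.span_singleton_pow, ← Submodule.add_eq_sup, ← Submodule.add_eq_sup]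
  ring

/-- **Chart of `x₃`** (`e₃ = 1`): the whole residual is the unit ideal. [folklore] -/
theorem chart3_top (w a u : A) :
    (Ideal.span {w} ⊔ Ideal.span {(1 : A) ^ 2} ⊔ Ideal.span {u ^ 2}) *
      (Ideal.span {w} ⊔ (Ideal.span {a} ⊔ Ideal.span {(1 : A)} ⊔ Ideal.span {u}) ^ 2) *
      (Ideal.span {w} ⊔ (Ideal.span {a} ⊔ Ideal.span {(1 : A)} ⊔ Ideal.span {u}) *
        (Ideal.span {(1 : A)} ⊔ Ideal.span {u})) *
      (Ideal.span {w} * (Ideal.span {a} ⊔ Ideal.span {(1 : A)} ⊔ Ideal.span {u}) ^ 2 ⊔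
        (Ideal.span {w} ⊔ (Ideal.span {a} ⊔ Ideal.span {(1 : A)} ⊔ Ideal.span {u}) *
          (Ideal.span {(1 : A)} ⊔ Ideal.span {u})) ^ 2) *
      (Ideal.span {a} ⊔ Ideal.span {(1 : A)} ⊔ Ideal.span {u}) = ⊤ := by
  simp only [one_pow, Ideal.span_singleton_one, sup_top_eq, top_sup_eq, top_sq, Ideal.mul_top]

end Algebra

/-! ## The member, its avatars, and their images on a Rees chart of `Bl_{(x)}` (any ring) -/

section Charts

variable {R : Type u} [CommRing R] (x : Fin 4 → R) (i : Fin 4)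

/-- `M = (x)` (the maximal ideal in the application). -/
local notation3 "M" => Ideal.span (Set.range x)
/-- The quadric `q = x₀x₁ + x₂x₃`. -/
local notation3 "qc" => (x 0 * x 1 + x 2 * x 3)
/-- The member `I = (q, x₃²) + M⁴`. -/
local notation3 "Ic" => (Ideal.span {qc} ⊔ Ideal.span {x 3 ^ 2} ⊔ Ideal.span (Set.range x) ^ 4)
/-- The avatar of the line `L₀`: `P₁ = (x₀, x₃) + M²`. -/
local notation3 "P₁" => (Ideal.span {x 0} ⊔ Ideal.span {x 3} ⊔ Ideal.span (Set.range x) ^ 2)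
/-- `D₀ = (x₃) + M²` (the member hyperplane thickened). -/
local notation3 "D₀" => (Ideal.span {x 3} ⊔ Ideal.span (Set.range x) ^ 2)
/-- The avatar of the surface `S₁`: `P₂ = (q) + P₁²`. -/
local notation3 "P₂" => (Ideal.span {qc} ⊔ P₁ ^ 2)
/-- The avatar of the line `L₁″`: `P₃ = q M + P₁ D₀ M`. -/
local notation3 "P₃" => (Ideal.span {qc} * Ideal.span (Set.range x) ⊔ P₁ * D₀ * Ideal.span (Set.range x))
/-- The avatar of the surface `S₂`: `P₄ = q P₁² M² + P₃²`. -/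
local notation3 "P₄" => (Ideal.span {qc} * P₁ ^ 2 * Ideal.span (Set.range x) ^ 2 ⊔ P₃ ^ 2)
/-- The chart data: `u = x_i/1`, `e_j = x_j/x_i`, `w = e₀e₁ + e₂e₃`. -/
local notation3 "φ" => chartBase x i
local notation3 "uu" => chartBase x i (x i)
local notation3 "e[" j "]" => chartGen x i j
local notation3 "wc" => (chartGen x i 0 * chartGen x i 1 + chartGen x i 2 * chartGen x i 3)
/-- The residuals on the chart. -/
local notation3 "Kc" => (Ideal.span {wc} ⊔ Ideal.span {e[3] ^ 2} ⊔ Ideal.span {uu ^ 2})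
local notation3 "CC" => (Ideal.span {e[0]} ⊔ Ideal.span {e[3]} ⊔ Ideal.span {uu})
local notation3 "DD" => (Ideal.span {e[3]} ⊔ Ideal.span {uu})

/-- The quadric on a chart: `φ(q) = u² · w`. [cite: StacksProject, Tag 0804] -/
theorem map_q : φ qc = uu ^ 2 * wc := by
  rw [map_add, map_mul, map_mul, reesChartBase_apply_eq_mul_chartGen x i 0,
    reesChartBase_apply_eq_mul_chartGen x i 1, reesChartBase_apply_eq_mul_chartGen x i 2,
    reesChartBase_apply_eq_mul_chartGen x i 3]
  ring

/-- **The member on a chart**: `I · B_i = u² · ((w) + (e₃²) + (u²))`. [cite: StacksProject, Tag 0804] -/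
theorem map_member : (Ic).map φ = Ideal.span {uu ^ 2} * Kc := by
  rw [Ideal.map_sup, Ideal.map_sup, map_span_singleton, map_span_singleton, map_M_pow, map_q, map_pow,
    reesChartBase_apply_eq_mul_chartGen x i 3]
  have e1 : (uu * e[3]) ^ 2 = uu ^ 2 * e[3] ^ 2 := by ring
  have e2 : uu ^ 4 = uu ^ 2 * uu ^ 2 := by ring
  rw [e1, e2, Ideal.mul_sup, Ideal.mul_sup, Ideal.span_singleton_mul_span_singleton,
    Ideal.span_singleton_mul_span_singleton, Ideal.span_singleton_mul_span_singleton]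

/-- **The avatar of `L₀` on a chart**: `P₁ · B_i = u · ((e₀) + (e₃) + (u))`. [cite: StacksProject, Tag 0804] -/
theorem map_P₁ : (P₁).map φ = Ideal.span {uu} * CC := by
  rw [Ideal.map_sup, Ideal.map_sup, map_span_singleton, map_span_singleton, map_M_pow,
    reesChartBase_apply_eq_mul_chartGen x i 0, reesChartBase_apply_eq_mul_chartGen x i 3]
  exact factor_three _ _ _

/-- `D₀ · B_i = u · ((e₃) + (u))`. [cite: StacksProject, Tag 0804] -/
theorem map_D₀ : (D₀).map φ = Ideal.span {uu} * DD := by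
  rw [Ideal.map_sup, map_span_singleton, map_M_pow, reesChartBase_apply_eq_mul_chartGen x i 3]
  exact factor_two _ _

/-- **The avatar of `S₁` on a chart**: `P₂ · B_i = u² · ((w) + C²)`. [cite: StacksProject, Tag 0804] -/
theorem map_P₂ : (P₂).map φ = Ideal.span {uu ^ 2} * (Ideal.span {wc} ⊔ CC ^ 2) := by
  rw [Ideal.map_sup, map_span_singleton, map_q, Ideal.map_pow, map_P₁]
  exact factor_P₂ _ _ _

/-- **The avatar of `L₁″` on a chart**: `P₃ · B_i = u³ · ((w) + C·D)`. [cite: StacksProject, Tag 0804] -/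
theorem map_P₃ : (P₃).map φ = Ideal.span {uu ^ 3} * (Ideal.span {wc} ⊔ CC * DD) := by
  rw [Ideal.map_sup, Ideal.map_mul, Ideal.map_mul, Ideal.map_mul, map_span_singleton, map_q,
    map_reesChartBase_eq (x i) (Ideal.mem_span_range_self (f := x) (x := i)), map_P₁, map_D₀]
  exact factor_P₃ _ _ _ _

/-- **The avatar of `S₂` on a chart**: `P₄ · B_i = u⁶ · ((w)·C² + ((w) + C·D)²)`.
[cite: StacksProject, Tag 0804] -/
theorem map_P₄ : (P₄).map φ =
    Ideal.span {uu ^ 6} * (Ideal.span {wc} * CC ^ 2 ⊔ (Ideal.span {wc} ⊔ CC * DD) ^ 2) := by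
  rw [Ideal.map_sup, Ideal.map_mul, Ideal.map_mul, Ideal.map_pow, Ideal.map_pow, Ideal.map_pow,
    map_span_singleton, map_q, map_reesChartBase_eq (x i) (Ideal.mem_span_range_self (f := x) (x := i)),
    map_P₁, map_P₃]
  exact factor_P₄ _ _ _ _

set_option maxHeartbeats 400000 in
-- instance-path defeq through `HomogeneousLocalization`'s standalone `Pow`/`Mul` (as in p508825)
/-- **THE CHART IMAGE OF `I · P₁P₂P₃P₄`** on every Rees chart `D₊(x_i t)` of `Bl_M Spec R`:
`(I P₁P₂P₃P₄) B_i = u¹⁴ · ((K · J₁ · A₁ · T₁) · C)`. [cite: StacksProject, Tag 0804] -/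
theorem map_member_mul_Q₀ : (Ic * (P₁ * P₂ * P₃ * P₄)).map φ =
    Ideal.span {uu ^ 14} * ((Kc * (Ideal.span {wc} ⊔ CC ^ 2) * (Ideal.span {wc} ⊔ CC * DD) *
      (Ideal.span {wc} * CC ^ 2 ⊔ (Ideal.span {wc} ⊔ CC * DD) ^ 2)) * CC) := by
  rw [Ideal.map_mul, Ideal.map_mul, Ideal.map_mul, Ideal.map_mul, map_member, map_P₁, map_P₂, map_P₃, map_P₄]
  exact collect_member _ _ _ _ _ _

/-- `P₁P₂P₃P₄ ⊇ M²¹`. [folklore] -/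
theorem pow_le_Q₀ : Ideal.span (Set.range x) ^ 21 ≤ P₁ * P₂ * P₃ * P₄ := by
  have h1 : M ^ 2 ≤ P₁ := le_sup_right
  have hD : M ^ 2 ≤ D₀ := le_sup_right
  have h2 : M ^ 2 * M ^ 2 ≤ P₂ := (Ideal.mul_mono h1 h1).trans (by rw [← sq]; exact le_sup_right)
  have h3 : M ^ 2 * M ^ 2 * M ≤ P₃ := (Ideal.mul_mono (Ideal.mul_mono h1 hD) le_rfl).trans le_sup_right
  have h4 : (M ^ 2 * M ^ 2 * M) * (M ^ 2 * M ^ 2 * M) ≤ P₄ :=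
    (Ideal.mul_mono h3 h3).trans (by rw [← sq]; exact le_sup_right)
  have e : M ^ 21 = M ^ 2 * (M ^ 2 * M ^ 2) * (M ^ 2 * M ^ 2 * M) * ((M ^ 2 * M ^ 2 * M) * (M ^ 2 * M ^ 2 * M)) := by
    ring
  rw [e]
  exact Ideal.mul_mono (Ideal.mul_mono (Ideal.mul_mono h1 h2) h3) h4

end Charts

/-! ## The member over a regular local ring of embedding dimension four -/

section LocalRung

variable {S : Type u} [CommRing S] [IsRegularLocalRing S] (x : Fin 4 → S)
  (hx : Ideal.span (Set.range x) = IsLocalRing.maximalIdeal S)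
  (hd : (IsLocalRing.maximalIdeal S).spanFinrank = 4)

/-- The quadric `q = x₀x₁ + x₂x₃`. -/
local notation3 "qc" => (x 0 * x 1 + x 2 * x 3)
/-- The member `I = (q, x₃²) + 𝔪⁴`. -/
local notation3 "Ic" => (Ideal.span {qc} ⊔ Ideal.span {x 3 ^ 2} ⊔ Ideal.span (Set.range x) ^ 4)
/-- The avatar of `L₀`. -/
local notation3 "P₁" => (Ideal.span {x 0} ⊔ Ideal.span {x 3} ⊔ Ideal.span (Set.range x) ^ 2)
/-- `D₀ = (x₃) + 𝔪²`. -/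
local notation3 "D₀" => (Ideal.span {x 3} ⊔ Ideal.span (Set.range x) ^ 2)
/-- The avatar of `S₁`. -/
local notation3 "P₂" => (Ideal.span {qc} ⊔ P₁ ^ 2)
/-- The avatar of `L₁″`. -/
local notation3 "P₃" => (Ideal.span {qc} * Ideal.span (Set.range x) ⊔ P₁ * D₀ * Ideal.span (Set.range x))
/-- The avatar of `S₂`. -/
local notation3 "P₄" => (Ideal.span {qc} * P₁ ^ 2 * Ideal.span (Set.range x) ^ 2 ⊔ P₃ ^ 2)

include hx hd in
set_option maxHeartbeats 800000 in
-- instance-path defeq through `HomogeneousLocalization`'s standalone `Mul`/`Add`/`Pow`/`One`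
/-- **Every Rees chart of `Bl_𝔪 Spec S` blown up along `(I P₁P₂P₃P₄) · B_i` is regular**
(`i = 3`: unit; `i = 0`: the conic tower along `L₁`; `i = 1`: the conic tower along `L₀` with the
avatars of the absent centres; `i = 2`: the crossing tower).
[cite: Liu2002, Thm. 8.1.19 (a)] [cite: StacksProject, Tag 080A] [cite: StacksProject, Tag 0BIQ] -/
theorem isRegular_charts (i : Fin 4) (Y : Scheme.{u}) (ρ : Y ⟶ Spec (.of (chartRing x i)))
    (hρ : IsBlowup ρ (affineBlowup.idealSheaf ((Ic * (P₁ * P₂ * P₃ * P₄)).map (chartBase x i)))) :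
    Scheme.IsRegular Y := by
  haveI : IsRegularRing S := isRegularRing_of_isRegularLocalRing S
  haveI : IsDomain S := isDomain_of_isRegularLocalRing S
  haveI hmax : (Ideal.span (Set.range x)).IsMaximal := hx ▸ IsLocalRing.maximalIdeal.isMaximal S
  haveI : IsRegularRing (S ⧸ Ideal.span (Set.range x)) := by
    letI := Ideal.Quotient.field (Ideal.span (Set.range x))
    infer_instance
  haveI : IsDomain (S ⧸ Ideal.span (Set.range x)) := Ideal.Quotient.isDomain _
  have hq : IsQuasiRegular x := isQuasiRegular_regularSystemOfParameters hd x hx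
  haveI hB : IsRegularRing (chartRing x i) := isRegularRing_blowupChart x i hq
  have hu : chartBase x i (x i) ∈ (chartRing x i)⁰ :=
    reesChartBase_mem_nonZeroDivisors (x i) (Ideal.mem_span_range_self (f := x) (x := i))
  have he : chartGen x i i = 1 := eq_one_of_eq_mul_self hu (reesChartBase_apply_eq_mul_chartGen x i i)
  -- a member of a regular system of parameters is non-zero
  have hxne : ∀ j : Fin 4, x j ≠ 0 := by
    intro j h0
    have h := hq 1 (MvPolynomial.X j) (MvPolynomial.isHomogeneous_X _ j)
      (by rw [MvPolynomial.eval_X, h0]; exact Ideal.zero_mem _)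
    rw [MvPolynomial.mem_map_C_iff] at h
    have h1 := h (Finsupp.single j 1)
    simp only [MvPolynomial.coeff_X] at h1
    exact hmax.ne_top ((Ideal.eq_top_iff_one _).mpr h1)
  rw [map_member_mul_Q₀] at hρ
  have hi : i = 0 ∨ i = 1 ∨ i = 2 ∨ i = 3 := by fin_cases i <;> simp
  rcases hi with rfl | rfl | rfl | rfl
  · -- chart of `x₀`: `e₀ = 1`, `w = e₁ + e₂e₃`, the avatar of `L₀` is a unit: conic tower along `L₁`
    rw [he, one_mul_cr (A := chartRing x 0), Ideal.span_singleton_one, top_sup_eq, top_sup_eq,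
      reduce_top (A := chartRing x 0), span_sup_pair_eq (A := chartRing x 0),
      host_sup_centre_sq (A := chartRing x 0)] at hρ
    obtain ⟨hq3, hreg3⟩ := hyps_host_add x 0 ⟨1, by decide⟩ ⟨2, by decide⟩ ⟨3, by decide⟩ hq
      (by decide) (by decide)
    refine CoreRungTower.isRegular_of_isBlowup_span_singleton_mul (pow_mem hu 14) _ (fun Y' ρ' h' => ?_) hρ
    exact conicTower_isRegular _ _ _ hq3 hreg3 h'
  · -- chart of `x₁`: `e₁ = 1`, `w = e₀ + e₂e₃`, the avatar of `L₀` is the conic centre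
    rw [he, mul_one_cr (A := chartRing x 1),
      centre_eq_of_sub_mem (A := chartRing x 1) (chartBase x 1 (x 1)) (chartGen x 1 3)
        (chartGen x 1 0 + chartGen x 1 2 * chartGen x 1 3) (chartGen x 1 0)
        (Ideal.mem_span_singleton'.mpr ⟨-chartGen x 1 2, by ring⟩)] at hρ
    obtain ⟨hq3, hreg3⟩ := hyps_host_add x 1 ⟨0, by decide⟩ ⟨2, by decide⟩ ⟨3, by decide⟩ hq
      (by decide) (by decide)
    refine CoreRungTower.isRegular_of_isBlowup_span_singleton_mul (pow_mem hu 14) _ (fun Y' ρ' h' => ?_) hρ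
    exact conicTowerPlus_isRegular _ _ _ hq3 hreg3 h'
  · -- chart of `x₂`: `e₂ = 1`, `w = e₀e₁ + e₃`: the crossing tower
    rw [he, one_mul_cr (A := chartRing x 2)] at hρ
    obtain ⟨hwa, hrega, hw0⟩ := hyps_host_mul_left x 2 ⟨0, by decide⟩ ⟨1, by decide⟩ ⟨3, by decide⟩ hq
      (hxne 2) (by decide) (by decide)
    obtain ⟨hwb, hregb⟩ := hyps_host_mul_right x 2 ⟨0, by decide⟩ ⟨1, by decide⟩ ⟨3, by decide⟩ hq
      (by decide) (by decide)
    refine CoreRungTower.isRegular_of_isBlowup_span_singleton_mul (pow_mem hu 14) _ (fun Y' ρ' h' => ?_) hρ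
    exact crossingTower_isRegular _ _ _ _ hwa hwb hw0 hrega hregb h'
  · -- chart of `x₃`: `e₃ = 1`, residual `(1)`
    rw [he, chart3_top (A := chartRing x 3), Ideal.mul_top] at hρ
    exact isRegular_of_isBlowup_span_singleton_nzd (pow_mem hu 14) hρ

include hx hd in
/-- **The tower is regular**: every blowing up of `Spec S` along `(I · P₁P₂P₃P₄) · 𝔪` is regular.
[cite: StacksProject, Tag 080A] -/
theorem isRegular_of_isBlowup_member_mul_companion {Y : Scheme.{u}} {f : Y ⟶ Spec (.of S)}
    (hf : IsBlowup f (affineBlowup.idealSheaf ((Ic * (P₁ * P₂ * P₃ * P₄)) * IsLocalRing.maximalIdeal S))) :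
    Scheme.IsRegular Y := by
  rw [← hx] at hf
  exact isRegular_of_isBlowup_mul_of_charts x _ (isRegular_charts x hx hd) hf

include hx hd in
/-- **The crossing-lines member is in the companion class** (W2 / r1d format; companion
`P₁P₂P₃P₄ · 𝔪 ⊇ 𝔪²²`; the member written with `𝔪⁴`). [cite: StacksProject, Tag 080A] -/
theorem companion_member :
    ∃ (Q : Ideal S) (m' : ℕ), IsLocalRing.maximalIdeal S ^ m' ≤ Q ∧
      ∃ (B : Scheme.{u}) (b : B ⟶ Spec (.of S)),
        IsBlowup b (affineBlowup.idealSheaf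
          ((Ideal.span {qc} ⊔ Ideal.span {x 3 ^ 2} ⊔ IsLocalRing.maximalIdeal S ^ 4) * Q)) ∧
        Scheme.IsRegular B := by
  obtain ⟨B, b, hb⟩ := exists_isBlowup (Spec (.of S))
    (affineBlowup.idealSheaf ((Ic * (P₁ * P₂ * P₃ * P₄)) * IsLocalRing.maximalIdeal S))
  have hII : Ideal.span {qc} ⊔ Ideal.span {x 3 ^ 2} ⊔ IsLocalRing.maximalIdeal S ^ 4 = Ic := by rw [hx]
  refine ⟨(P₁ * P₂ * P₃ * P₄) * IsLocalRing.maximalIdeal S, 22, ?_, B, b, by rwa [hII, ← mul_assoc],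
    isRegular_of_isBlowup_member_mul_companion x hx hd hb⟩
  rw [pow_succ]
  exact Ideal.mul_mono (by rw [← hx]; exact pow_le_Q₀ x) le_rfl

include hx hd in
/-- **CORE RUNG — the crossing-lines member.** `S` regular local of embedding dimension four,
`x₀, …, x₃` a regular system of parameters: every blowing up `T` of `Spec S` along
`I = (x₀x₁ + x₂x₃, x₃²) + 𝔪⁴` satisfies the conclusion of the blow-up-form open core.
[cite: StacksProject, Tag 080A] [cite: GortzWedhorn2020, Prop. 13.91 (2)] -/
theorem coreRung_member (h𝔪 : IsLocalRing.maximalIdeal S ≠ ⊥) (T : Scheme.{u}) (f : T ⟶ Spec (.of S))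
    (hf : IsBlowup f (affineBlowup.idealSheaf
      (Ideal.span {qc} ⊔ Ideal.span {x 3 ^ 2} ⊔ IsLocalRing.maximalIdeal S ^ 4))) :
    ∃ (J : T.IdealSheafData) (T' : Scheme.{u}) (π : T' ⟶ T), J ≠ ⊥ ∧
      (∀ t : T, t ∈ J.support → f.base t = IsLocalRing.closedPoint S) ∧
      IsBlowup π J ∧ Scheme.IsRegular T' := by
  rw [← hx] at hf
  have hI : Ic ≠ ⊥ := fun h =>
    span_sup_pow_maximalIdeal_ne_bot h𝔪 (Ideal.span {qc} ⊔ Ideal.span {x 3 ^ 2}) 4 (by rw [hx] at h; exact h)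
  exact atomConclusion_of_pointBlowup_charts x hx h𝔪 hI (N := 21) (by rw [← hx]; exact pow_le_Q₀ x)
    (isRegular_charts x hx hd) T f hf

end LocalRung

/-- **The `ringKrullDim S = 4` shape.** [cite: StacksProject, Tag 080A] [cite: Liu2002, Thm. 8.1.19 (a)] -/
theorem coreRung_member_of_ringKrullDim {S : Type u} [CommRing S] [IsRegularLocalRing S]
    (x : Fin 4 → S) (hx : Ideal.span (Set.range x) = IsLocalRing.maximalIdeal S)
    (hdim : ringKrullDim S = (4 : ℕ)) (T : Scheme.{u}) (f : T ⟶ Spec (.of S))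
    (hf : IsBlowup f (affineBlowup.idealSheaf
      (Ideal.span {x 0 * x 1 + x 2 * x 3} ⊔ Ideal.span {x 3 ^ 2} ⊔ Ideal.span (Set.range x) ^ 4))) :
    ∃ (J : T.IdealSheafData) (T' : Scheme.{u}) (π : T' ⟶ T), J ≠ ⊥ ∧
      (∀ t : T, t ∈ J.support → f.base t = IsLocalRing.closedPoint S) ∧
      IsBlowup π J ∧ Scheme.IsRegular T' := by
  have hd : (IsLocalRing.maximalIdeal S).spanFinrank = 4 := by
    have h := IsRegularLocalRing.spanFinrank_maximalIdeal (R := S)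
    rw [hdim] at h
    exact_mod_cast h
  have h𝔪 : IsLocalRing.maximalIdeal S ≠ ⊥ := fun hbot => by
    have h0 := ringKrullDim_eq_zero_of_isField (IsLocalRing.isField_iff_maximalIdeal_eq.mpr hbot)
    rw [hdim] at h0
    exact absurd h0 (by norm_num)
  rw [hx] at hf
  exact coreRung_member x hx hd h𝔪 T f hf

/-- **The registered core's binder shape (`stub_atomDimFourBlowup`), restricted to the
crossing-lines member** `I = (x₀x₁ + x₂x₃, x₃²) + 𝔪⁴`; the characteristic, completeness,
residue-field and off-fibre hypotheses are not used (underscored). [cite: StacksProject, Tag 080A] -/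
theorem atomDimFourBlowupAt_member (p : ℕ) (_hp : p.Prime) (S : Type)
    [CommRing S] [IsRegularLocalRing S] [CharP S p]
    [IsAdicComplete (IsLocalRing.maximalIdeal S) S]
    [PerfectField (IsLocalRing.ResidueField S)] (hS : ringKrullDim S = (4 : ℕ))
    (x : Fin 4 → S) (hx : Ideal.span (Set.range x) = IsLocalRing.maximalIdeal S)
    (T : Scheme.{0}) (f : T ⟶ Spec (.of S))
    (hf : IsBlowup f (affineBlowup.idealSheaf
      (Ideal.span {x 0 * x 1 + x 2 * x 3} ⊔ Ideal.span {x 3 ^ 2} ⊔ Ideal.span (Set.range x) ^ 4)))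
    (_hoff : ∀ t : T, f.base t ≠ IsLocalRing.closedPoint S →
      IsRegularLocalRing (T.presheaf.stalk t)) :
    ∃ (J : T.IdealSheafData) (T' : Scheme.{0}) (π : T' ⟶ T), J ≠ ⊥ ∧
      (∀ t : T, t ∈ J.support → f.base t = IsLocalRing.closedPoint S) ∧
      IsBlowup π J ∧ Scheme.IsRegular T' :=
  coreRung_member_of_ringKrullDim x hx hS T f hf

end CrossingLines

end Summit.ResolutionOfSingularities.ResolutionOfSingularities.Theorems

end
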